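import Literature.Topology.FourManifolds.PontryaginThomTransversality
import Literature.Topology.FourManifolds.RegularValuePreimage
import Literature.Topology.FourManifolds.PontryaginThomLevelFraming
import Literature.Topology.FourManifolds.RegularLevelSplitting
import Literature.Topology.FourManifolds.BallComplementFraming
import Literature.Topology.FourManifolds.HomotopySpheresBP
import HarnessLib

/-!
# The bounding manifold of Kervaire–Milnor's Lemma 4.2: `W = G⁻¹(y) ∩ {‖p‖ ≥ 1}`

Topic `Literature/Topology/FourManifolds`; second `(b)`-specific step of the proof of the named
fact `Literature.Topology.FourManifolds.boundsParallelizable_of_collapseNullHomotopic`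
(`PontryaginThomCollapse.lean`; Kervaire–Milnor, *Groups of homotopy spheres I*, Ann. of Math.
77 (1963), Lemma 4.2 `⇒`, p. 510: *"then `M` bounds a manifold `W ⊂ Dⁿ⁺ᵏ⁺¹`, where `φ`
extends to a field `ψ` of normal frames over `W`"* — here with its s-parallelisability,
*"It follows from Lemma 3.3 … "*, the parallelisability proper being Lemma 3.4,
`HomotopySpheresSignatureProofs.lean` / the sequel).

From the transversality datum of `PontryaginThomTransversality.lean` (a `C^∞` map
`g : ℝᴺ → ℝᵏ`, `N = n + k + 1`, a regular value `y` on an open `O ⊆ ℝᴺ ∖ 0`, the level being the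
cone over the slice `tube (M × {y})` near the unit sphere and compact in `‖p‖ ≥ 1`) and the
regular value theorem (`RegularValuePreimage.lean`: the level `Z = O ∩ g⁻¹(y)` is an embedded
`(n+1)`-manifold `e : Z ↪ ℝᴺ` with `de(TZ) = ker dg`) we build
(`FramedTubularEmbedding.exists_nullCobordism_isStablyParallelizable`):

* `W = {z ∈ Z | ‖e z‖ ≥ 1}`, the regular sublevel set `{1 - ‖e‖² ≤ 0}` of the tree
  (`RegularLevelSplitting.lean`, `Literature.Topology.FourManifolds.RegularSublevel`): a compact
  `C^∞` manifold with boundary `{‖e‖ = 1}`; the level is regular because the radial vector is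
  tangent to the cone `Z ∩ {1 - δ < ‖p‖ < 1 + δ}` but not to the unit sphere;
* the identification `M ≅ ∂W`, `x ↦` the point of `Z` over `tube (x, y)`, a diffeomorphism onto
  the boundary manifold of the tree's boundary datum (`RegularSublevel.boundaryData`), with inverse
  `∂W → Sᴺ⁻¹ → tube → M`; whence a null-cobordism `M = ∂W`
  (`Literature.Topology.FourManifolds.NullCobordism`, `HomotopySpheresBP.lean`);
* the s-parallelisability of `W`: `TZ ⊕ ℝ` is framed along `W ↪ Z`
  (`PontryaginThomLevelFraming.lean`, Lemmas 3.3/3.5) and the inclusion `W ↪ Z` has invertible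
  differential (`RegularSublevel.det_mfderiv_incl_ne_zero`), so `TW ⊕ ℝ` is framed
  (`IsStablyParallelizable.of_hasStableTangentFramingAlong_of_isInvertible_mfderiv`,
  `BallComplementFraming.lean`).

Everything here is proved; no definitions, no named facts.

## References

* M. Kervaire, J. Milnor, *Groups of homotopy spheres I*, Ann. of Math. (2) 77 (1963),
  Lemma 4.2 and its proof (p. 510), Lemmas 3.3–3.5 (p. 509). doi:10.2307/1970128
  [KervaireMilnorAnnals1963]
* A. Kosinski, *Differential Manifolds* (1993), Ch. IX §2 (framed submanifolds), (5.5).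
  [Kosinski1993]
-/

open scoped Manifold ContDiff Topology RealInnerProductSpace
open Set Function Metric Filter Module

noncomputable section

namespace Literature.Topology.FourManifolds

namespace FramedTubularEmbedding

variable {n k : ℕ} {M : Type} [TopologicalSpace M] [ChartedSpace (EuclideanSpace ℝ (Fin n)) M]
  [IsManifold (𝓡 n) ∞ M] [CompactSpace M]

/-- **The bounding manifold of Kervaire–Milnor's Lemma 4.2, s-parallelisable.**  Let `E` be a
framed tubular embedding of the compact non-empty `n`-manifold `M`
into `Sⁿ⁺ᵏ`, `k ≥ 1`, whose Pontryagin–Thom collapse is null-homotopic.  Then `M` is the boundary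
of a compact `C^∞` manifold `W` (a `NullCobordism` of `M`) which is stably parallelisable:
`W = G⁻¹(y) ∩ {‖p‖ ≥ 1} ⊆ ℝⁿ⁺ᵏ⁺¹` for the smoothed radial null-homotopy `G` and a regular value `y`
(`exists_regular_level_of_collapseNullHomotopic`, `exists_regularPreimage_of_contDiffOn`), with
`∂W = Z ∩ Sⁿ⁺ᵏ ≅ tube (M × {y}) ≅ M`, and `TW ⊕ ℝ` framed by peeling the gradient frame of the
normal bundle (`hasStableTangentFramingAlong_of_regularPreimage`).  Kervaire–Milnor 1963, proof of
Lemma 4.2 (p. 510) with Lemma 3.3 (p. 509).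
[cite: KervaireMilnorAnnals1963, Lemma 4.2 (proof, p. 510) and Lemma 3.3 (p. 509)] -/
theorem exists_nullCobordism_isStablyParallelizable [Nonempty M] (E : FramedTubularEmbedding n k M)
    (hk : 1 ≤ k) (hE : E.CollapseNullHomotopic) :
    ∃ c : NullCobordism.{0} n M, IsStablyParallelizable (𝓡∂ (n + 1)) c.W := by
  classical
  -- `Fact (finrank ℝ ℝⁿ⁺ᵏ⁺¹ = n + k + 1)`, under which Mathlib charts the round sphere `Sⁿ⁺ᵏ`
  haveI : Fact (Module.finrank ℝ (EuclideanSpace ℝ (Fin (n + k + 1))) = n + k + 1) :=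
    ⟨finrank_euclideanSpace_fin⟩
  set A := EuclideanSpace ℝ (Fin (n + k + 1)) with hA
  have h0 : (∞ : ℕ∞ω) ≠ 0 := by simp
  -- the transversality datum and the regular level `Z`
  obtain ⟨g, y, O, δ, hg, hO, hδ0, hδ1, hO0, hreg, hcpt, hshell⟩ :=
    E.exists_regular_level_of_collapseNullHomotopic hE
  have hN : n + k + 1 = (n + 1) + k := by ring
  obtain ⟨Z, _, _, _, _, _, e, he, hre, hte⟩ :=
    exists_regularPreimage_of_contDiffOn hN hO hg.contDiffOn y hreg
  have hesm : ContMDiff (𝓡 (n + 1)) (𝓡 (n + k + 1)) ∞ e := he.contMDiff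
  have hmem : ∀ z, e z ∈ O ∧ g (e z) = y := fun z ↦ by
    have := mem_range_self (f := e) z
    rw [hre] at this
    exact ⟨this.1, this.2⟩
  have hsurj : ∀ z, Surjective (fderiv ℝ g (e z)) := fun z ↦ hreg _ (hmem z).1 (hmem z).2
  -- the radial vector is tangent to the level at the points of norm `1`
  have hradial : ∀ z, ‖e z‖ = 1 → fderiv ℝ g (e z) (e z) = 0 := by
    intro z hz1
    obtain ⟨x, hx⟩ := (hshell (e z) (by rw [hz1]; linarith) (by rw [hz1]; linarith)).1 (hmem z)
    have hray : ∀ s : ℝ, 1 - δ < s → s < 1 + δ → g (s • e z) = y := by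
      intro s hs1 hs2
      have hs0 : 0 < s := by linarith
      have hns : ‖s • e z‖ = s := by
        rw [norm_smul, hz1, mul_one, Real.norm_of_nonneg hs0.le]
      refine ((hshell (s • e z) (by rw [hns]; exact hs1) (by rw [hns]; exact hs2)).2 ⟨x, ?_⟩).2
      rw [hns, smul_smul, inv_mul_cancel₀ hs0.ne', one_smul, ← hx, hz1, inv_one, one_smul]
    have hgd : DifferentiableAt ℝ g (e z) := hg.differentiable h0 _
    have h1 : HasDerivAt (fun s : ℝ ↦ g (s • e z)) (fderiv ℝ g (e z) (e z)) 1 := by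
      have hl : HasDerivAt (fun s : ℝ ↦ s • e z) (e z) 1 := by
        simpa using (hasDerivAt_id (1 : ℝ)).smul_const (e z)
      have hgd' : HasFDerivAt g (fderiv ℝ g (e z)) ((1 : ℝ) • e z) := by
        rw [one_smul]; exact hgd.hasFDerivAt
      exact hgd'.comp_hasDerivAt (1 : ℝ) hl
    have h2 : HasDerivAt (fun s : ℝ ↦ g (s • e z)) 0 1 := by
      refine (hasDerivAt_const (1 : ℝ) y).congr_of_eventuallyEq ?_
      have : Ioo (1 - δ) (1 + δ) ∈ 𝓝 (1 : ℝ) := Ioo_mem_nhds (by linarith) (by linarith)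
      filter_upwards [this] with s hs using hray s hs.1 hs.2
    exact h1.unique h2
  -- the function `F = 1 - ‖e‖²` and its regular level `0`
  set F : Z → ℝ := fun z ↦ 1 - ‖e z‖ ^ 2 with hF
  have hFsm : ContMDiff (𝓡 (n + 1)) 𝓘(ℝ, ℝ) ∞ F :=
    contMDiff_const.sub ((contDiff_norm_sq ℝ).comp_contMDiff hesm)
  have hF0 : ∀ z, F z = 0 ↔ ‖e z‖ = 1 := fun z ↦ by
    rw [hF]
    simp only
    rw [sub_eq_zero, eq_comm, pow_eq_one_iff_of_nonneg (norm_nonneg _) two_ne_zero]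
  have hFle : ∀ z, F z ≤ 0 ↔ 1 ≤ ‖e z‖ := fun z ↦ by
    rw [hF]
    simp only
    constructor
    · intro h
      by_contra hlt
      push Not at hlt
      nlinarith [norm_nonneg (e z)]
    · intro h
      nlinarith
  have hlev : IsRegularLevel (𝓡 (n + 1)) F 0 := by
    refine ⟨hFsm, fun z _ ↦ BoundarylessManifold.isInteriorPoint, fun z hz hcrit ↦ ?_⟩
    have hz1 : ‖e z‖ = 1 := (hF0 z).1 hz
    obtain ⟨u, hu⟩ := (hte z (e z)).1 (hradial z hz1)
    have hd : HasFDerivAt (fun x : A ↦ (1 : ℝ) - ‖x‖ ^ 2) (-(2 • innerSL ℝ (e z))) (e z) :=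
      (hasStrictFDerivAt_norm_sq (e z)).hasFDerivAt.const_sub 1
    have hmf : mfderiv (𝓡 (n + 1)) 𝓘(ℝ, ℝ) F z u = (-(2 • innerSL ℝ (e z))) (e z) := by
      rw [show F = (fun x : A ↦ (1 : ℝ) - ‖x‖ ^ 2) ∘ e from rfl,
        mfderiv_comp z hd.differentiableAt.mdifferentiableAt (hesm.mdifferentiableAt h0),
        mfderiv_eq_fderiv, hd.fderiv]
      show (-(2 • innerSL ℝ (e z))) (mfderiv (𝓡 (n + 1)) (𝓡 (n + k + 1)) e z u) = _
      rw [hu]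
    have happ : (-(2 • innerSL ℝ (e z))) (e z) = -(2 • ⟪e z, e z⟫) := rfl
    have h0' : mfderiv (𝓡 (n + 1)) 𝓘(ℝ, ℝ) F z u = 0 := by
      rw [show mfderiv (𝓡 (n + 1)) 𝓘(ℝ, ℝ) F z = 0 from hcrit]
      rfl
    rw [hmf, happ, real_inner_self_eq_norm_sq, hz1, one_pow, two_nsmul] at h0'
    have h0'' : (-(1 + 1) : ℝ) = 0 := h0'
    norm_num at h0''
  -- the bounding manifold `W = {F ≤ 0}`, compact
  have hWcpt : IsCompact (F ⁻¹' Iic (0 : ℝ)) := by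
    rw [he.isEmbedding.isCompact_iff]
    convert hcpt using 1
    ext p
    constructor
    · rintro ⟨z, hz, rfl⟩
      exact ⟨(hmem z).1, (hmem z).2, (hFle z).1 hz⟩
    · rintro ⟨hpO, hgp, hp1⟩
      have : p ∈ range e := by rw [hre]; exact ⟨hpO, hgp⟩
      obtain ⟨z, rfl⟩ := this
      exact ⟨z, (hFle z).2 hp1, rfl⟩
  haveI hWc : CompactSpace (RegularSublevel hlev) := isCompact_iff_compactSpace.1 hWcpt
  set b := RegularSublevel.boundaryData hlev with hb
  -- the points of `Z` over the slice `tube (M × {y})`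
  have htube_mem : ∀ x : M, (E.tube (x, y) : A) ∈ range e := fun x ↦ by
    rw [hre]
    have h1 : ‖(E.tube (x, y) : A)‖ = 1 := norm_eq_of_mem_sphere _
    exact (hshell _ (by rw [h1]; linarith) (by rw [h1]; linarith)).2
      ⟨x, by rw [h1, inv_one, one_smul]⟩
  set homeo := he.isEmbedding.toHomeomorph with hhomeo
  set ι₀ : M → Z := fun x ↦ homeo.symm ⟨(E.tube (x, y) : A), htube_mem x⟩ with hι₀
  have hι₀e : ∀ x, e (ι₀ x) = (E.tube (x, y) : A) := fun x ↦
    congrArg Subtype.val (homeo.apply_symm_apply ⟨_, htube_mem x⟩)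
  have htubec : Continuous fun x : M ↦ (E.tube (x, y) : A) :=
    continuous_subtype_val.comp (E.isSmoothEmbedding.isEmbedding.continuous.comp
      (continuous_id.prodMk continuous_const))
  have hι₀c : Continuous ι₀ := homeo.symm.continuous.comp (htubec.subtype_mk _)
  have hι₀sm : ContMDiff (𝓡 n) (𝓡 (n + 1)) ∞ ι₀ := by
    refine (ContMDiff.iff_comp_isImmersion he.isImmersion).2 ⟨hι₀c, ?_⟩
    have : e ∘ ι₀ = fun x ↦ (E.tube (x, y) : A) := funext hι₀e
    rw [this]
    exact contMDiff_coe_sphere.comp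
      (E.isSmoothEmbedding.contMDiff.comp (contMDiff_id.prodMk contMDiff_const))
  have hFι₀ : ∀ x, F (ι₀ x) = 0 := fun x ↦ (hF0 _).2 (by rw [hι₀e]; exact norm_eq_of_mem_sphere _)
  -- the map `M → ∂W` and its inverse
  set wpt : M → RegularSublevel hlev := fun x ↦ RegularSublevel.mk hlev (ι₀ x) (hFι₀ x).le
    with hwpt
  have hwbd : ∀ x, wpt x ∈ (𝓡∂ (n + 1)).boundary (RegularSublevel hlev) := fun x ↦
    (RegularSublevel.mem_boundary_iff hlev _).2 (hFι₀ x)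
  have hwptc : Continuous wpt := hι₀c.subtype_mk _
  have hwptsm : ContMDiff (𝓡 n) (𝓡∂ (n + 1)) ∞ wpt :=
    (ContMDiff.iff_comp_isImmersion (RegularSublevel.isSmoothEmbedding_incl hlev).isImmersion).2
      ⟨hwptc, hι₀sm⟩
  set φf : M → b.carrier := fun x ↦ ⟨wpt x, hwbd x⟩ with hφf
  have hφfc : Continuous φf := hwptc.subtype_mk _
  have hφfsm : ContMDiff (𝓡 n) (𝓡 n) ∞ φf :=
    (ContMDiff.iff_comp_isImmersion b.isSmoothEmbedding.isImmersion).2 ⟨hφfc, hwptsm⟩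
  -- the inverse `∂W → M`: read the tube coordinate of `e`
  obtain ⟨x₀⟩ := (inferInstance : Nonempty M)
  set θ₀ : sphere (0 : A) 1 := E.tube (x₀, 0) with hθ₀
  have hinj : Injective E.tube := E.isSmoothEmbedding.isEmbedding.injective
  set tinv : sphere (0 : A) 1 → M × EuclideanSpace ℝ (Fin k) := invFun E.tube with htinv
  have htinv_apply : ∀ q : M × EuclideanSpace ℝ (Fin k), tinv (E.tube q) = q :=
    leftInverse_invFun hinj
  set P : A → M := fun p ↦ (tinv (unitDir θ₀ p)).1 with hP
  set C₀ : Set A := {0}ᶜ ∩ unitDir θ₀ ⁻¹' range E.tube with hC₀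
  have hPsm : ContMDiffOn 𝓘(ℝ, A) (𝓡 n) ∞ P C₀ := by
    have h1 : ContMDiffOn 𝓘(ℝ, A) ((𝓡 n).prod 𝓘(ℝ, EuclideanSpace ℝ (Fin k))) ∞
        (tinv ∘ unitDir θ₀) C₀ :=
      (Literature.Geometry.Manifold.contMDiffOn_invFun_range E.isSmoothEmbedding).comp
        ((contMDiffOn_unitDir θ₀).mono inter_subset_left) fun p hp ↦ hp.2
    exact contMDiff_fst.comp_contMDiffOn h1
  have hdir_unit : ∀ q : sphere (0 : A) 1, unitDir θ₀ (q : A) = q := fun q ↦ by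
    simpa using unitDir_smul θ₀ q one_pos
  -- boundary points of `W` sit over the slice
  have hbd_slice : ∀ c : b.carrier, ∃ x : M, e (RegularSublevel.incl hlev c.1) =
      (E.tube (x, y) : A) ∧ ι₀ x = RegularSublevel.incl hlev c.1 := by
    intro c
    set z := RegularSublevel.incl hlev c.1 with hz
    have hz1 : ‖e z‖ = 1 := (hF0 z).1 ((RegularSublevel.mem_boundary_iff hlev _).1 c.2)
    obtain ⟨x, hx⟩ := (hshell (e z) (by rw [hz1]; linarith) (by rw [hz1]; linarith)).1 (hmem z)
    rw [hz1, inv_one, one_smul] at hx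
    refine ⟨x, hx, he.isEmbedding.injective ?_⟩
    rw [hι₀e, hx]
  set ψ : b.carrier → M := fun c ↦ P (e (RegularSublevel.incl hlev c.1)) with hψ
  have hψsm : ContMDiff (𝓡 n) (𝓡 n) ∞ ψ := by
    refine hPsm.comp_contMDiff (hesm.comp ((RegularSublevel.contMDiff_incl hlev).comp
      b.isSmoothEmbedding.contMDiff)) fun c ↦ ?_
    obtain ⟨x, hx, -⟩ := hbd_slice c
    show e (RegularSublevel.incl hlev c.1) ∈ C₀
    rw [hx]
    refine ⟨fun h0 ↦ ?_, ?_⟩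
    · have := norm_eq_of_mem_sphere (E.tube (x, y))
      rw [(h0 : (E.tube (x, y) : A) = 0), norm_zero] at this
      exact zero_ne_one this
    · show unitDir θ₀ (E.tube (x, y) : A) ∈ range E.tube
      rw [hdir_unit]; exact mem_range_self _
  have hleft : ∀ x, ψ (φf x) = x := fun x ↦ by
    show P (e (ι₀ x)) = x
    rw [hP]
    simp only
    rw [hι₀e, hdir_unit, htinv_apply]
  have hright : ∀ c, φf (ψ c) = c := fun c ↦ by
    obtain ⟨x, hx, hι⟩ := hbd_slice c
    have hψc : ψ c = x := by
      show P (e (RegularSublevel.incl hlev c.1)) = x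
      rw [hx, hP]
      simp only
      rw [hdir_unit, htinv_apply]
    rw [hψc]
    apply Subtype.ext
    apply (RegularSublevel.injective_incl hlev)
    show RegularSublevel.incl hlev (wpt x) = RegularSublevel.incl hlev c.1
    rw [← hι]
    rfl
  let Φ : M ≃ₘ^∞⟮𝓡 n, 𝓡 n⟯ b.carrier :=
    { toFun := φf
      invFun := ψ
      left_inv := hleft
      right_inv := hright
      contMDiff_toFun := hφfsm
      contMDiff_invFun := hψsm }
  -- the null-cobordism
  let c : NullCobordism.{0} n M :=
    { W := RegularSublevel hlev
      incl := b.incl ∘ Φ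
      isSmoothEmbedding_incl := b.isSmoothEmbedding.comp_diffeomorph Φ
      range_incl := by
        have hΦs : Function.Surjective Φ := fun c ↦ ⟨ψ c, hright c⟩
        rw [range_comp, hΦs.range_eq, image_univ]
        exact b.range_incl }
  -- s-parallelisability of `W`
  have hstab : HasStableTangentFramingAlong (𝓡 (n + 1)) Z (RegularSublevel.incl hlev) :=
    hasStableTangentFramingAlong_of_regularPreimage (𝓡∂ (n + 1)) (S := RegularSublevel hlev)
      hN hk finrank_euclideanSpace_fin hO hg.contDiffOn he (fun z ↦ (hmem z).1) hte hsurj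
      (RegularSublevel.continuous_incl hlev)
  refine ⟨c, IsStablyParallelizable.of_hasStableTangentFramingAlong_of_isInvertible_mfderiv
    ((RegularSublevel.contMDiff_incl hlev).of_le (by exact_mod_cast le_top))
    (fun p ↦ ContinuousLinearMap.isInvertible_of_det_ne_zero'
      (RegularSublevel.det_mfderiv_incl_ne_zero hlev p)) hstab⟩

end FramedTubularEmbedding

end Literature.Topology.FourManifolds

end
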